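import Summits.CriticalPhenomena.PercolationContinuityZ3.Theorems.Transplant.TriClawXTableOKA
import Summits.CriticalPhenomena.PercolationContinuityZ3.Theorems.Transplant.TriClawXTableOKB
import Summits.CriticalPhenomena.PercolationContinuityZ3.Theorems.Transplant.TriClawXTableOKC
import Summits.CriticalPhenomena.PercolationContinuityZ3.Theorems.Transplant.TriClawXTableOKD
import Summits.CriticalPhenomena.PercolationContinuityZ3.Theorems.Transplant.TriClawXSound
import Summits.CriticalPhenomena.PercolationContinuityZ3.Theorems.Transplant.TriClawXCols
import HarnessLib

/-!
# `F □ 𝕋`, p205010-free routing V: THE PLANAR HEXAGONAL CLAW EXISTS for every column-certified terminal triple of every block pair (the 28 kernel theorems + the mirror),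
# in the form the column sets of «TriClawXCols» ask for

builds on p205010 (kernel theorem, internal audit signed; external expert review pending) — NOT used in this file.
Lane `prim-bschramm`, seat `prim-bschramm-p2` (gen 51; class C1b, METHOD = input substitution; memo `HOME/bschramm/P2-LATTICES.md` §162); helper file
(`--supports stmt-CriticalPhenomena-4575 --as helper`).  Hexagonal twin of «BccClawXLegs» §1.
* §1 `triClawXOK_three` (the `28` classes with `t_R = 3` from «TriClawXTableOK{A,B,C,D}»), **`exists_claw`** (every clip class: the mirror «TriClawXSound».`mir` for `t_R < 3`);
* §2 **`exists_claw_of_tgtCols`** — the planar input of the 3D template «ProdTriHubRoute» in the form «ProdTriHexShadow».`ColRouting` asks for (tree target columns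
  `TriClawX.tgtCols`, class codes `(min t_R 3, min t_D 4, min s_R 3, min s_D 4)`).
[cite: DuminilCopinSidoraviciusTassion2016, §2.3 (proof of Fact 2: the three disjoint paths in B̄_R(z))]
-/

namespace Summit.CriticalPhenomena.PercolationContinuityZ3.Theorems.Transplant

namespace TriClawX

open Literature.Probability.Percolation Literature.Probability.LatticeModels SimpleGraph
open TriClaw (Pt tn adjb H3list mem_H3list)
open BccClawX (rel pt_rel rel_pt codes_ok)

/-! ## §1 The rule succeeds on every clip class (the 28 kernel theorems and their mirror images) -/

/-- **The rule succeeds for every clip class with `t_R = 3`** (`t_D ∈ {3,4}`, `s_R ≤ 3`, `s_R ≤ s_D ≤ 4`; the `28` kernel theorems of «TriClawXTableOK{A,B,C,D}», in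
the `TriClawXOK` spelling of «TriClawXTable»). [folklore] -/
theorem triClawXOK_three {cD cS cE : ℕ} (hD : 3 ≤ cD) (hD' : cD ≤ 4) (hS : cS ≤ 3) (hE : cE ≤ 4) (hSE : cS ≤ cE) : TriClawXOK 3 cD cS cE := by
  rcases (by omega : cD = 3 ∨ cD = 4) with rfl | rfl
  · rcases (by omega : cS = 0 ∨ cS = 1 ∨ cS = 2 ∨ cS = 3) with rfl | rfl | rfl | rfl
    · rcases (by omega : cE = 0 ∨ cE = 1 ∨ cE = 2 ∨ cE = 3 ∨ cE = 4) with rfl | rfl | rfl | rfl | rfl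
      exacts [triClawXOK_3300, triClawXOK_3301, triClawXOK_3302, triClawXOK_3303, triClawXOK_3304]
    · rcases (by omega : cE = 1 ∨ cE = 2 ∨ cE = 3 ∨ cE = 4) with rfl | rfl | rfl | rfl
      exacts [triClawXOK_3311, triClawXOK_3312, triClawXOK_3313, triClawXOK_3314]
    · rcases (by omega : cE = 2 ∨ cE = 3 ∨ cE = 4) with rfl | rfl | rfl
      exacts [triClawXOK_3322, triClawXOK_3323, triClawXOK_3324]
    · rcases (by omega : cE = 3 ∨ cE = 4) with rfl | rfl
      exacts [triClawXOK_3333, triClawXOK_3334]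
  · rcases (by omega : cS = 0 ∨ cS = 1 ∨ cS = 2 ∨ cS = 3) with rfl | rfl | rfl | rfl
    · rcases (by omega : cE = 0 ∨ cE = 1 ∨ cE = 2 ∨ cE = 3 ∨ cE = 4) with rfl | rfl | rfl | rfl | rfl
      exacts [triClawXOK_3400, triClawXOK_3401, triClawXOK_3402, triClawXOK_3403, triClawXOK_3404]
    · rcases (by omega : cE = 1 ∨ cE = 2 ∨ cE = 3 ∨ cE = 4) with rfl | rfl | rfl | rfl
      exacts [triClawXOK_3411, triClawXOK_3412, triClawXOK_3413, triClawXOK_3414]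
    · rcases (by omega : cE = 2 ∨ cE = 3 ∨ cE = 4) with rfl | rfl | rfl
      exacts [triClawXOK_3422, triClawXOK_3423, triClawXOK_3424]
    · rcases (by omega : cE = 3 ∨ cE = 4) with rfl | rfl
      exacts [triClawXOK_3433, triClawXOK_3434]

/-- **THE CLAW EXISTS for every admissible configuration of every clip class** (codes `c_R ≤ 3`, `c_D ≤ 4`, `c_S ≤ 3`, `c_E ≤ 4`, `c_R ≤ c_D`, `c_S ≤ c_E`,
`c_R = 3 ∨ c_S = 3`): directly from the kernel theorems when `c_R = 3`, through the mirror `(a, b) ↦ (a + b, −b)` («TriClawXSound» §2) when `c_R < 3`.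
[cite: DuminilCopinSidoraviciusTassion2016, §2.3 (proof of Fact 2: the three disjoint paths)] -/
theorem exists_claw {cR cD cS cE : ℕ} (hR : cR ≤ 3) (hD : cD ≤ 4) (hS : cS ≤ 3) (hE : cE ≤ 4) (hRD : cR ≤ cD) (hSE : cS ≤ cE) (hone : cR = 3 ∨ cS = 3)
    {a1 a2 a3 : Pt} (h1 : a1 ∈ tgtRList cR cD cS cE) (h2 : a2 ∈ tgtRList cR cD cS cE) (h3 : a3 ∈ tgtList cR cD cS cE)
    (hadm : admissible a1 a2 a3 = true) : ∃ (q : Pt) (l1 l2 l3 : List Pt), ClawProps cR cD cS cE a1 a2 a3 q l1 l2 l3 := by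
  by_cases h3R : cR = 3
  · subst h3R
    have := (triClawXOK_iff _ _ _ _).1 (triClawXOK_three hRD hD hS hE hSE) a1 h1 a2 h2 a3 h3 hadm
    obtain ⟨⟨q, l1, l2, l3⟩, hsome⟩ := Option.isSome_iff_exists.1 this
    exact ⟨q, l1, l2, l3, clawX_sound hsome⟩
  · have hS3 : cS = 3 := hone.resolve_left h3R
    subst hS3
    rw [tgtRList, List.mem_filter] at h1 h2
    rw [tgtList, List.mem_filter] at h3
    have h1' : mir a1 ∈ tgtRList 3 cE cR cD := by
      rw [tgtRList, List.mem_filter, isTgtR_mir]; exact ⟨mir_mem_H3list h1.1, h1.2⟩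
    have h2' : mir a2 ∈ tgtRList 3 cE cR cD := by
      rw [tgtRList, List.mem_filter, isTgtR_mir]; exact ⟨mir_mem_H3list h2.1, h2.2⟩
    have h3' : mir a3 ∈ tgtList 3 cE cR cD := by
      rw [tgtList, List.mem_filter, Bool.and_eq_true, isTgt_mir, mir_beq_zero]; exact ⟨mir_mem_H3list h3.1, by simpa using h3.2⟩
    have hadm' : admissible (mir a1) (mir a2) (mir a3) = true := by rw [admissible_mir]; exact hadm
    have := (triClawXOK_iff _ _ _ _).1 (triClawXOK_three hSE hE hR hD hRD) (mir a1) h1' (mir a2) h2' (mir a3) h3' hadm'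
    obtain ⟨⟨q, l1, l2, l3⟩, hsome⟩ := Option.isSome_iff_exists.1 this
    exact ⟨mir q, l1.map mir, l2.map mir, l3.map mir, (clawX_sound hsome).unmir⟩

/-! ## §2 The planar claw for a column-certified triple (tree form of the hypotheses) -/

/-- **THE PLANAR CLAW for a column-certified triple** (tree form of the hypotheses — target columns of «TriClawXCols» —, model form of the conclusion, relative to `z`).
[cite: DuminilCopinSidoraviciusTassion2016, §2.3 (proof of Fact 2: the three disjoint paths in B̄_R(z))] -/
theorem exists_claw_of_tgtCols {z : Site 2} {tR tD sR sD : ℕ} (hRD : tR ≤ tD) (hSE : sR ≤ sD) (hone : 3 ≤ tR ∨ 3 ≤ sR) {a₁ a₂ a₃ : Site 2}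
    (h1 : a₁ ∈ tgtCols z tR tD sR sD) (h1R : a₁ ∈ blkR 3 z tR sR) (h1z : a₁ ≠ z) (h2 : a₂ ∈ tgtCols z tR tD sR sD) (h2R : a₂ ∈ blkR 3 z tR sR) (h2z : a₂ ≠ z)
    (h3 : a₃ ∈ tgtCols z tR tD sR sD) (h3z : a₃ ≠ z) (h31 : a₃ ≠ a₁) (h32 : a₃ ≠ a₂) :
    ∃ (q : Pt) (l1 l2 l3 : List Pt), ClawProps (min tR 3) (min tD 4) (min sR 3) (min sD 4) (rel z a₁) (rel z a₂) (rel z a₃) q l1 l2 l3 := by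
  obtain ⟨cR, cD, cS, cE, cRD, cSE, cone⟩ := codes_ok hRD hSE hone
  refine exists_claw cR cD cS cE cRD cSE cone (mem_tgtRList h1 h1R h1z) (mem_tgtRList h2 h2R h2z) (mem_tgtList h3 h3z) ?_
  have hne1 : rel z a₃ ≠ rel z a₁ := fun h => h31 (by rw [← pt_rel z a₃, h, pt_rel])
  have hne2 : rel z a₃ ≠ rel z a₂ := fun h => h32 (by rw [← pt_rel z a₃, h, pt_rel])
  simp only [admissible, Bool.and_eq_true, Bool.not_eq_true', beq_eq_false_iff_ne, ne_eq]
  exact ⟨hne1, hne2⟩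

end TriClawX

end Summit.CriticalPhenomena.PercolationContinuityZ3.Theorems.Transplant
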